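import Summits.BirchSwinnertonDyer.BirchSwinnertonDyer.Theorems.SoloInformedJointGrossZagier

/-!
# SoloInformedHeightPencil — the pencil of `p`-adic heights and the splitting-free radical

The transcendence input isolated in `SoloInformedJointGrossZagier` / `SoloInformedJointUniform`
(non-degeneracy of THE canonical `p`-adic height on the Gross–Zagier lattice at some ordinary `p`)
refers to ONE `p`-adic height. But `p`-adic heights on `E(ℚ)` come in a PENCIL: Nekovář's height
attached to a splitting of the Hodge filtration of `D_cris(V_pE)` depends on the splitting only
through a multiple of `log_ω ⊗ log_ω` (Coleman–Gross: changing the complement `W` of `Fil⁰` changes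
the normalised differential of the third kind `ω_D` by `c·log_ω(D)·ω`, hence the local height at
`p` by `c·log_ω(D₁)·log_ω(D₂)`). For `E/ℚ` non-CM and `p` good ordinary the two Frobenius
eigenlines give two DISTINCT members: the canonical (unit-root, Mazur–Tate/Schneider) height `h_α`
and the critical-slope height `h_β`; each has its own `p`-adic Gross–Zagier formula in analytic
rank one (Perrin-Riou 1987 for `α`; Büyükboduk–Pollack–Sasaki, arXiv:1811.08216, Thm. 1.1.1 and
Cor. 1.1.2 for `β`: `L'_{p,β}(f,1) = (1 - 1/β)² c(f) h_β(P_f,P_f)`), and BPS Thm. 1.1.6 proves: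
`ord_{s=1} L(f,s) = 1 ⇒ h_α` or `h_β` is non-degenerate.

This file types the pencil abstractly and proves the one piece of linear algebra that governs it.
Two height data `D₁, D₂` lie on one pencil in the direction of an additive `ℓ : E(ℚ) →+ ℚ_p` (the
abelian logarithm `log_ω` in the application) when `⟨P,Q⟩_{D₂} = ⟨P,Q⟩_{D₁} - t·ℓ(P)·ℓ(Q)`
(hypothesis `h` of the theorems below; nothing is constructed).

* `soloInformedPencil_common_radical` (SYMMETRIC PENCIL LEMMA): if two distinct members of the
  pencil `B - s·v vᵀ` (`B` symmetric) are singular, there is a non-zero COMMON radical vector `x`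
  with `B x = 0` and `v·x = 0` — and then every member is singular
  (`soloInformedPencil_det_eq_zero_of_common_radical`). Proof: kernel vectors `xᵢ` satisfy
  `B xᵢ = sᵢ (v·xᵢ) v`; symmetry gives `(s₁ - s₂)(v·x₁)(v·x₂) = 0`.
* `soloInformedPencil_dichotomy` / `soloInformedPencil_ne_zero_or`: for a family `P` of rational
  points, two distinct pencil members (`t ≠ 0`) both have zero Gram determinant on `P` iff the Gram
  matrix of `D₁` has a non-zero kernel vector inside the hyperplane `Σ xᵢ ℓ(Pᵢ) = 0` — a
  SPLITTING-FREE condition (on `ker ℓ` all members of the pencil agree).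
* `soloInformedPencil_fin_one_ne_zero_or`: on one point with `ℓ(P) ≠ 0` two distinct members
  cannot both vanish (`ĥ_{D₂}(P) = ĥ_{D₁}(P) - t·ℓ(P)²`). With `ℓ = log_ω` (injective modulo torsion
  on `E(ℚ_p)`) this is the elementary core of BPS Thm. 1.1.6, valid for every non-torsion point and
  without any hypothesis on the analytic rank; `soloInformedPencil_rank_eq_one` is the resulting
  rank-one certificate with no Schneider-type hypothesis.
* `soloInformedPencil_rank_eq` (TWO-SLOPE RANK CERTIFICATE): if at ONE good ordinary `p ≥ 5` the
  `r`-th coefficients of two `p`-adic `L`-functions — the unit-root one of the tree (Kato's bound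
  `kato_selmerCorank_le_order_padicLFunction`) and an abstract second one `L₂` with its own
  Kato-type bound `corank Sel_{p^∞} ≤ ord L₂` (placeholder for the critical-slope `L_{p,β}`: not in
  the tree) — are expressed by two DISTINCT pencil members on an `r`-family `P` carrying the
  archimedean identity `L^{(r)}(E,1)/r! = c·Ω⁺·det⟨Pᵢ,Pⱼ⟩_NT`, and the Gram matrix of `D₁` on `P`
  has no kernel vector in `ker(x ↦ Σ xᵢ ℓ(Pᵢ))`, then `rank E(ℚ) = r` and `corank Ш[p^∞] = 0`.

Reading for the summit (`BirchSwinnertonDyer`): granted both joint identities `(ZZ_r)_α`, `(ZZ_r)_β`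
and both Kato divisibilities, excess rank `rank E(ℚ) > r_an = r ≥ 2` forces, at EVERY good ordinary
`p`, a non-zero `x ∈ ℚ_p^r` with `Σ xᵢ log_ω(Pᵢ) = 0` and `Σ xᵢ ⟨Pᵢ,Pⱼ⟩_p = 0 (∀ j)` on the
Gross–Zagier family: all `r × r` minors of the `r × (r+1)` matrix `[log_ω(Pᵢ) | ⟨Pᵢ,Pⱼ⟩_p]` vanish.
At `r = 1` this is impossible (`log_ω(P) ≠ 0`), which is why rank one needs no transcendence; at
`r = 2` it is ONE proportionality `(log P₁ : ⟨P₁,P₁⟩ : ⟨P₁,P₂⟩) = (log P₂ : ⟨P₂,P₁⟩ : ⟨P₂,P₂⟩)` with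
transcendental ratio `log P₁ / log P₂` (p-adic analytic subgroup theorem) among `p`-adic periods of
1-motives — a QUADRATIC relation, outside the range of the (linear) analytic subgroup theorem.
Nothing in this file asserts a conjecture or constructs a height; `D₁`, `D₂`, `ℓ`, `t`, `L₂`, `e₁`,
`e₂` are parameters.
-/

noncomputable section

open scoped Classical MatrixGroups ModularForm

open CongruenceSubgroup Literature.NumberTheory.EllipticCurves
  Literature.NumberTheory.EllipticCurves.ModularForms WeierstrassCurve WeierstrassCurve.Affine.Point
  Matrix

namespace Summit.BirchSwinnertonDyer.BirchSwinnertonDyer.Theorems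

/-! ### Linear algebra of a symmetric rank-one pencil `B - s·v vᵀ` -/

section LinearAlgebra

variable {ι : Type*} [Fintype ι] {K : Type*} [Field K]

/-- `(B - s·v vᵀ) x = B x - s (v·x) v`. [folklore] -/
theorem soloInformedPencil_member_mulVec (B : Matrix ι ι K) (v : ι → K) (s : K) (x : ι → K) :
    (B - s • vecMulVec v v) *ᵥ x = B *ᵥ x - (s * (v ⬝ᵥ x)) • v := by
  ext i
  simp only [Matrix.mulVec, dotProduct, Pi.sub_apply, Pi.smul_apply, smul_eq_mul,
    Matrix.sub_apply, Matrix.smul_apply, vecMulVec_apply, sub_mul, Finset.sum_sub_distrib]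
  congr 1
  rw [Finset.mul_sum, Finset.sum_mul]
  exact Finset.sum_congr rfl fun j _ => by ring

/-- A common radical vector `x` (`B x = 0`, `v·x = 0`, `x ≠ 0`) makes EVERY member of the pencil
singular. [folklore] -/
theorem soloInformedPencil_det_eq_zero_of_common_radical (B : Matrix ι ι K) (v : ι → K)
    {x : ι → K} (hx : x ≠ 0) (hBx : B *ᵥ x = 0) (hvx : v ⬝ᵥ x = 0) (s : K) :
    (B - s • vecMulVec v v).det = 0 := by
  refine Matrix.exists_mulVec_eq_zero_iff.mp ⟨x, hx, ?_⟩
  rw [soloInformedPencil_member_mulVec, hBx, hvx, mul_zero, zero_smul, sub_zero]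

/-- **Symmetric pencil lemma.** Let `B` be a symmetric matrix over a field and `v` a vector. If
two DISTINCT members `B - s₁·v vᵀ`, `B - s₂·v vᵀ` of the pencil are singular, then there is a
non-zero common radical vector: `x ≠ 0` with `B x = 0` and `v·x = 0` (hence every member is
singular). Proof: kernel vectors `xᵢ` satisfy `B xᵢ = sᵢ (v·xᵢ) v`; if `v·x₁ = 0` or `v·x₂ = 0`
that vector works; otherwise `x₂ᵀ B x₁ = x₁ᵀ B x₂` gives `(s₁ - s₂)(v·x₁)(v·x₂) = 0`, absurd.
[folklore] -/
theorem soloInformedPencil_common_radical (B : Matrix ι ι K) (hB : Bᵀ = B) (v : ι → K)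
    {s₁ s₂ : K} (hs : s₁ ≠ s₂) (h₁ : (B - s₁ • vecMulVec v v).det = 0)
    (h₂ : (B - s₂ • vecMulVec v v).det = 0) :
    ∃ x : ι → K, x ≠ 0 ∧ B *ᵥ x = 0 ∧ v ⬝ᵥ x = 0 := by
  obtain ⟨x₁, hx₁, hk₁⟩ := Matrix.exists_mulVec_eq_zero_iff.mpr h₁
  obtain ⟨x₂, hx₂, hk₂⟩ := Matrix.exists_mulVec_eq_zero_iff.mpr h₂
  rw [soloInformedPencil_member_mulVec, sub_eq_zero] at hk₁ hk₂
  by_cases hv₁ : v ⬝ᵥ x₁ = 0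
  · exact ⟨x₁, hx₁, by rw [hk₁, hv₁, mul_zero, zero_smul], hv₁⟩
  by_cases hv₂ : v ⬝ᵥ x₂ = 0
  · exact ⟨x₂, hx₂, by rw [hk₂, hv₂, mul_zero, zero_smul], hv₂⟩
  exfalso
  have hsym : x₂ ⬝ᵥ B *ᵥ x₁ = x₁ ⬝ᵥ B *ᵥ x₂ := by
    conv_lhs => rw [← hB]
    exact dotProduct_transpose_mulVec B x₂ x₁
  rw [hk₁, hk₂, dotProduct_smul, dotProduct_smul, smul_eq_mul, smul_eq_mul, dotProduct_comm x₂ v,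
    dotProduct_comm x₁ v] at hsym
  have h0 : (s₁ - s₂) * ((v ⬝ᵥ x₁) * (v ⬝ᵥ x₂)) = 0 := by linear_combination hsym
  rcases mul_eq_zero.mp h0 with h | h
  · exact hs (sub_eq_zero.mp h)
  · exact (mul_ne_zero hv₁ hv₂) h

/-- Contrapositive form: no common radical vector in `ker(v·)` ⇒ of two distinct members at most
one is singular. [folklore] -/
theorem soloInformedPencil_det_ne_zero_or (B : Matrix ι ι K) (hB : Bᵀ = B) (v : ι → K)
    {s₁ s₂ : K} (hs : s₁ ≠ s₂) (hR : ∀ x : ι → K, B *ᵥ x = 0 → v ⬝ᵥ x = 0 → x = 0) :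
    (B - s₁ • vecMulVec v v).det ≠ 0 ∨ (B - s₂ • vecMulVec v v).det ≠ 0 := by
  by_contra h
  rw [not_or, not_not, not_not] at h
  obtain ⟨x, hx, hBx, hvx⟩ := soloInformedPencil_common_radical B hB v hs h.1 h.2
  exact hx (hR x hBx hvx)

end LinearAlgebra

/-! ### Two height data differing by a multiple of `ℓ ⊗ ℓ` -/

section Pencil

variable {W : WeierstrassCurve ℚ} {p : ℕ} [Fact p.Prime]

/-- An additive map `E(ℚ) →+ ℚ_p` kills torsion (`ℚ_p` is torsion-free) — so `D - t·ℓ⊗ℓ` is again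
a height datum (symmetric, vanishing on torsion): the pencil through `D` in the direction `ℓ⊗ℓ`.
[folklore] -/
theorem soloInformedPencil_map_torsion (ℓ : W.toAffine.Point →+ ℚ_[p]) {P : W.toAffine.Point}
    (hP : IsOfFinAddOrder P) : ℓ P = 0 := by
  obtain ⟨n, hn, hnP⟩ := hP.exists_nsmul_eq_zero
  have h : (n : ℚ_[p]) * ℓ P = 0 := by rw [← nsmul_eq_mul, ← map_nsmul, hnP, AddMonoidHom.map_zero]
  exact (mul_eq_zero.mp h).resolve_left (by exact_mod_cast hn.ne')

/-! Two height data `D₁, D₂` are members of one pencil in the direction `ℓ` when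
`⟨P,Q⟩_{D₂} = ⟨P,Q⟩_{D₁} - t·ℓ(P)·ℓ(Q)` for all `P, Q` (hypothesis `h` below). With `ℓ = log_ω` this
is how Nekovář's heights for two splittings of the Hodge filtration differ (Coleman–Gross); for `E`
non-CM and `p` ordinary the unit-root height `h_α` (canonical) and the critical-slope height `h_β`
are two such data with `t ≠ 0` (Büyükboduk–Pollack–Sasaki, arXiv:1811.08216, §1.1). -/

variable {D₁ D₂ : WeierstrassCurve.PAdicHeightData W p} {ℓ : W.toAffine.Point →+ ℚ_[p]} {t : ℚ_[p]}

/-- Gram matrices of two members of a pencil (`⟨P,Q⟩_{D₂} = ⟨P,Q⟩_{D₁} - t·ℓ(P)·ℓ(Q)`):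
`B₂ = B₁ - t·v vᵀ`, `vᵢ = ℓ(Pᵢ)`. [folklore] -/
theorem soloInformedPencil_pairingMatrix_eq (h : ∀ P Q, D₂.pairing P Q = D₁.pairing P Q - t * ℓ P * ℓ Q) {ι : Type*}
    (P : ι → W.toAffine.Point) :
    D₂.pairingMatrix P = D₁.pairingMatrix P - t • vecMulVec (fun i => ℓ (P i)) (fun i => ℓ (P i)) := by
  ext i j
  simp [WeierstrassCurve.PAdicHeightData.pairingMatrix, vecMulVec_apply, h (P i) (P j), mul_assoc]

/-- Gram determinant of the second member. [folklore] -/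
theorem soloInformedPencil_padicRegulatorOf_eq (h : ∀ P Q, D₂.pairing P Q = D₁.pairing P Q - t * ℓ P * ℓ Q) {ι : Type*}
    [Fintype ι] (P : ι → W.toAffine.Point) :
    padicRegulatorOf D₂ P =
      (D₁.pairingMatrix P - t • vecMulVec (fun i => ℓ (P i)) (fun i => ℓ (P i))).det := by
  unfold padicRegulatorOf
  rw [soloInformedPencil_pairingMatrix_eq h]

omit [Fact p.Prime] in
/-- Gram determinant of the first member, as the member `s = 0`. [folklore] -/
theorem soloInformedPencil_padicRegulatorOf_eq_zero_member [Fact p.Prime]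
    (D₁ : WeierstrassCurve.PAdicHeightData W p) (ℓ : W.toAffine.Point →+ ℚ_[p]) {ι : Type*}
    [Fintype ι] (P : ι → W.toAffine.Point) :
    padicRegulatorOf D₁ P =
      (D₁.pairingMatrix P - (0 : ℚ_[p]) • vecMulVec (fun i => ℓ (P i)) (fun i => ℓ (P i))).det := by
  rw [zero_smul, sub_zero]
  rfl

/-- **Dichotomy for two heights of one pencil.** If `D₁` and `D₂ = D₁ - t·ℓ⊗ℓ` (`t ≠ 0`) BOTH have
zero Gram determinant on the family `P`, the Gram matrix of `D₁` on `P` has a non-zero kernel vector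
`x` inside the hyperplane `Σ xᵢ ℓ(Pᵢ) = 0` — a splitting-free condition (on that hyperplane all
members of the pencil agree). [folklore] -/
theorem soloInformedPencil_dichotomy (h : ∀ P Q, D₂.pairing P Q = D₁.pairing P Q - t * ℓ P * ℓ Q) (ht : t ≠ 0)
    {ι : Type*} [Fintype ι] (P : ι → W.toAffine.Point) (h₁ : padicRegulatorOf D₁ P = 0)
    (h₂ : padicRegulatorOf D₂ P = 0) :
    ∃ x : ι → ℚ_[p], x ≠ 0 ∧ D₁.pairingMatrix P *ᵥ x = 0 ∧ (fun i => ℓ (P i)) ⬝ᵥ x = 0 := by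
  rw [soloInformedPencil_padicRegulatorOf_eq_zero_member D₁ ℓ] at h₁
  rw [soloInformedPencil_padicRegulatorOf_eq h] at h₂
  exact soloInformedPencil_common_radical _ (D₁.pairingMatrix_transpose P) _ ht.symm h₁ h₂

/-- Conversely a common radical vector in `ker(Σ xᵢ ℓ(Pᵢ))` kills the Gram determinants of both
(indeed of every member `D₁ - s·ℓ⊗ℓ`). [folklore] -/
theorem soloInformedPencil_padicRegulatorOf_eq_zero_of_common_radical
    (h : ∀ P Q, D₂.pairing P Q = D₁.pairing P Q - t * ℓ P * ℓ Q) {ι : Type*} [Fintype ι] (P : ι → W.toAffine.Point)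
    {x : ι → ℚ_[p]} (hx : x ≠ 0) (hBx : D₁.pairingMatrix P *ᵥ x = 0)
    (hvx : (fun i => ℓ (P i)) ⬝ᵥ x = 0) :
    padicRegulatorOf D₁ P = 0 ∧ padicRegulatorOf D₂ P = 0 := by
  rw [soloInformedPencil_padicRegulatorOf_eq_zero_member D₁ ℓ, soloInformedPencil_padicRegulatorOf_eq h]
  exact ⟨soloInformedPencil_det_eq_zero_of_common_radical _ _ hx hBx hvx 0,
    soloInformedPencil_det_eq_zero_of_common_radical _ _ hx hBx hvx t⟩

/-- No common radical vector in `ker(Σ xᵢ ℓ(Pᵢ))` ⇒ `D₁` or `D₂` has non-zero Gram determinant on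
`P`. [folklore] -/
theorem soloInformedPencil_ne_zero_or (h : ∀ P Q, D₂.pairing P Q = D₁.pairing P Q - t * ℓ P * ℓ Q) (ht : t ≠ 0)
    {ι : Type*} [Fintype ι] (P : ι → W.toAffine.Point)
    (hR : ∀ x : ι → ℚ_[p], D₁.pairingMatrix P *ᵥ x = 0 → (fun i => ℓ (P i)) ⬝ᵥ x = 0 → x = 0) :
    padicRegulatorOf D₁ P ≠ 0 ∨ padicRegulatorOf D₂ P ≠ 0 := by
  rw [soloInformedPencil_padicRegulatorOf_eq_zero_member D₁ ℓ, soloInformedPencil_padicRegulatorOf_eq h]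
  exact soloInformedPencil_det_ne_zero_or _ (D₁.pairingMatrix_transpose P) _ ht.symm hR

/-- One point: `ĥ_{D₂}(P) = ĥ_{D₁}(P) - t·ℓ(P)²`. [folklore] -/
theorem soloInformedPencil_padicRegulatorOf_fin_one (h : ∀ P Q, D₂.pairing P Q = D₁.pairing P Q - t * ℓ P * ℓ Q)
    (P : Fin 1 → W.toAffine.Point) :
    padicRegulatorOf D₂ P = padicRegulatorOf D₁ P - t * ℓ (P 0) ^ 2 := by
  rw [soloInformedJoint_padicRegulatorOf_fin_one, soloInformedJoint_padicRegulatorOf_fin_one,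
    h (P 0) (P 0)]
  ring

/-- On one point the radical condition is just `ℓ(P) ≠ 0`. [folklore] -/
theorem soloInformedPencil_noRadical_fin_one (D₁ : WeierstrassCurve.PAdicHeightData W p)
    (ℓ : W.toAffine.Point →+ ℚ_[p]) (P : Fin 1 → W.toAffine.Point) (hP : ℓ (P 0) ≠ 0)
    (x : Fin 1 → ℚ_[p]) (_hBx : D₁.pairingMatrix P *ᵥ x = 0)
    (hvx : (fun i => ℓ (P i)) ⬝ᵥ x = 0) : x = 0 := by
  have hx0 : x 0 = 0 := by
    have h : ℓ (P 0) * x 0 = 0 := by simpa [dotProduct, Fin.sum_univ_one] using hvx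
    exact (mul_eq_zero.mp h).resolve_left hP
  funext i
  fin_cases i
  simpa using hx0

/-- **Two heights of one pencil cannot both vanish on a point with `ℓ(P) ≠ 0`** — the elementary
core of Büyükboduk–Pollack–Sasaki, arXiv:1811.08216, Thm. 1.1.6 ("either `h_α` or `h_β` is
non-degenerate" in analytic rank one): with `ℓ = log_ω`, injective modulo torsion on `E(ℚ_p)`, it
holds for every non-torsion rational point, with no hypothesis on the analytic rank.
[cite: BuyukbodukPollackSasaki2018, Thm. 1.1.6] -/
theorem soloInformedPencil_fin_one_ne_zero_or (h : ∀ P Q, D₂.pairing P Q = D₁.pairing P Q - t * ℓ P * ℓ Q) (ht : t ≠ 0)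
    (P : Fin 1 → W.toAffine.Point) (hP : ℓ (P 0) ≠ 0) :
    padicRegulatorOf D₁ P ≠ 0 ∨ padicRegulatorOf D₂ P ≠ 0 :=
  soloInformedPencil_ne_zero_or h ht P (soloInformedPencil_noRadical_fin_one D₁ ℓ P hP)

end Pencil

/-! ### The two-slope rank certificate -/

section OneCurve

variable (W : WeierstrassCurve ℚ) [W.IsElliptic] [W.IsGloballyMinimal] (p : ℕ) [Fact p.Prime]
  {N : ℕ} [NeZero N] (f : CuspForm (Gamma0 N) 2)

omit [W.IsElliptic] [W.IsGloballyMinimal] [NeZero N] in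
/-- From an identity `[T^r]L · lg^r = c · e · det⟨Pᵢ,Pⱼ⟩_{D'}` with `c, e ≠ 0`: a non-zero Gram
determinant forces `[T^r]L ≠ 0`, hence `ord_T L ≤ r`. [folklore] -/
theorem soloInformedPencil_order_le_of_identity {r : ℕ} (L : PowerSeries ℚ_[p])
    (D' : WeierstrassCurve.PAdicHeightData W p) (P : Fin r → W.toAffine.Point) {c e lg : ℚ_[p]}
    (hc : c ≠ 0) (he : e ≠ 0)
    (h : PowerSeries.coeff r L * lg ^ r = c * e * padicRegulatorOf D' P)
    (hReg : padicRegulatorOf D' P ≠ 0) : L.order ≤ r := by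
  refine PowerSeries.order_le r ?_
  intro h0
  rw [h0, zero_mul] at h
  exact (mul_ne_zero (mul_ne_zero hc he) hReg) h.symm

/-- **Two-slope rank certificate.** Let `E/ℚ` (globally minimal `W`, newform `f`), `p ≥ 5` good
ordinary, `D₁`, `D₂ = D₁ - t·ℓ⊗ℓ` two height data of one pencil with `t ≠ 0`. Suppose an `r`-family
`P` and `c ∈ ℚ` carry the archimedean identity `L^{(r_an)}(E,1)/r_an! = c·Ω⁺_f·det⟨Pᵢ,Pⱼ⟩_NT` and two
`p`-adic identities `[T^r]L₁·lg^r = c·e₁·det⟨Pᵢ,Pⱼ⟩_{D₁}`, `[T^r]L₂·lg^r = c·e₂·det⟨Pᵢ,Pⱼ⟩_{D₂}`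
(`e₁, e₂ ≠ 0`), where `L₁ = L_p(f, α, T)` is the unit-root `p`-adic `L`-function (Kato's bound
`kato_selmerCorank_le_order_padicLFunction`, Astérisque 295 (2004), Thm. 18.4) and `L₂` is any power
series with a Kato-type bound `corank Sel_{p^∞} ≤ ord L₂` (placeholder for the critical-slope
`L_{p,β}` of Pollack–Stevens/Bellaïche with its `p`-adic Gross–Zagier formula, BPS Cor. 1.1.2 at
`r = 1`; neither object is in the tree). If the Gram matrix of `D₁` on `P` has no kernel vector in
`ker(Σ xᵢ ℓ(Pᵢ))`, then `rank E(ℚ) = r` and `corank Ш(E/ℚ)[p^∞] = 0`: `c ≠ 0` and `det_NT ≠ 0`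
(`L^{(r_an)}(E,1) ≠ 0`) give `r ≤ rank`; by the pencil lemma one of the two `p`-adic Gram
determinants is non-zero, so one of `ord L₁`, `ord L₂` is `≤ r`, and the matching Kato bound gives
`rank + corank Ш[p^∞] = corank Sel ≤ r`. [cite: BuyukbodukPollackSasaki2018, Cor. 1.1.2] -/
theorem soloInformedPencil_rank_eq {r : ℕ} (hE : hasEntireLFunction_rat) (hp : 5 ≤ p)
    (hord : IsOrdinaryAt W p) (hf : IsNewformOf W f)
    (hKato : kato_selmerCorank_le_order_padicLFunction W p (f := f))
    {D₁ D₂ : WeierstrassCurve.PAdicHeightData W p} {ℓ : W.toAffine.Point →+ ℚ_[p]} {t : ℚ_[p]}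
    (h : ∀ P Q, D₂.pairing P Q = D₁.pairing P Q - t * ℓ P * ℓ Q) (ht : t ≠ 0) (P : Fin r → W.toAffine.Point) (c : ℚ)
    {e₁ e₂ lg : ℚ_[p]} (he₁ : e₁ ≠ 0) (he₂ : e₂ ≠ 0) (L₂ : PowerSeries ℚ_[p])
    (hL : W.leadingLCoeff = (((c : ℝ) * plusPeriod f * regulatorOf P : ℝ) : ℂ))
    (h₁ : PowerSeries.coeff r (padicLFunction f (unitRoot W p : ℚ_[p])) * lg ^ r =
      (c : ℚ_[p]) * e₁ * padicRegulatorOf D₁ P)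
    (h₂ : PowerSeries.coeff r L₂ * lg ^ r = (c : ℚ_[p]) * e₂ * padicRegulatorOf D₂ P)
    (hKato₂ : (W.selmerCorank p : ℕ∞) ≤ L₂.order)
    (hR : ∀ x : Fin r → ℚ_[p], D₁.pairingMatrix P *ᵥ x = 0 → (fun i => ℓ (P i)) ⬝ᵥ x = 0 → x = 0) :
    W.mordellWeilRank = r ∧ W.shaCorank p = 0 := by
  obtain ⟨hc, hReg⟩ := soloInformedJoint_ne_zero_of_leadingLCoeff W f hE hL
  have hLB : r ≤ W.mordellWeilRank := by
    simpa using soloInformedJoint_card_le_mordellWeilRank_of_linearIndependent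
      (soloInformedJoint_linearIndependent_of_regulatorOf_ne_zero hReg)
  have hcp : (c : ℚ_[p]) ≠ 0 := by exact_mod_cast hc
  have hp2 : p ≠ 2 := by omega
  have hSel : W.selmerCorank p ≤ r := by
    rcases soloInformedPencil_ne_zero_or h ht P hR with hne | hne
    · have hord_le := soloInformedPencil_order_le_of_identity W p _ _ P hcp he₁ h₁ hne
      exact_mod_cast (hKato hp2 hord hf).trans hord_le
    · have hord_le := soloInformedPencil_order_le_of_identity W p _ _ P hcp he₂ h₂ hne
      exact_mod_cast hKato₂.trans hord_le
  have hid : W.selmerCorank p = W.mordellWeilRank + W.shaCorank p :=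
    W.selmerCorank_eq_mordellWeilRank_add_holds p
  exact ⟨by omega, by omega⟩

/-- The same, read as the summit equality for this curve when `r = r_an(E)`. [folklore] -/
theorem soloInformedPencil_analyticRank_eq {r : ℕ} (hE : hasEntireLFunction_rat) (hp : 5 ≤ p)
    (hord : IsOrdinaryAt W p) (hf : IsNewformOf W f) (hr : W.analyticRank = r)
    (hKato : kato_selmerCorank_le_order_padicLFunction W p (f := f))
    {D₁ D₂ : WeierstrassCurve.PAdicHeightData W p} {ℓ : W.toAffine.Point →+ ℚ_[p]} {t : ℚ_[p]}
    (h : ∀ P Q, D₂.pairing P Q = D₁.pairing P Q - t * ℓ P * ℓ Q) (ht : t ≠ 0) (P : Fin r → W.toAffine.Point) (c : ℚ)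
    {e₁ e₂ lg : ℚ_[p]} (he₁ : e₁ ≠ 0) (he₂ : e₂ ≠ 0) (L₂ : PowerSeries ℚ_[p])
    (hL : W.leadingLCoeff = (((c : ℝ) * plusPeriod f * regulatorOf P : ℝ) : ℂ))
    (h₁ : PowerSeries.coeff r (padicLFunction f (unitRoot W p : ℚ_[p])) * lg ^ r =
      (c : ℚ_[p]) * e₁ * padicRegulatorOf D₁ P)
    (h₂ : PowerSeries.coeff r L₂ * lg ^ r = (c : ℚ_[p]) * e₂ * padicRegulatorOf D₂ P)
    (hKato₂ : (W.selmerCorank p : ℕ∞) ≤ L₂.order)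
    (hR : ∀ x : Fin r → ℚ_[p], D₁.pairingMatrix P *ᵥ x = 0 → (fun i => ℓ (P i)) ⬝ᵥ x = 0 → x = 0) :
    W.analyticRank = W.mordellWeilRank := by
  rw [hr, (soloInformedPencil_rank_eq W p f hE hp hord hf hKato h ht P c he₁ he₂ L₂ hL h₁ h₂
    hKato₂ hR).1]

/-- **Rank one needs no radical hypothesis.** For a one-point family with `ℓ(P) ≠ 0` (for
`ℓ = log_ω`: `P` non-torsion) the radical condition is automatic, so the two identities and the two
Kato-type bounds alone give `rank E(ℚ) = 1` and `corank Ш[p^∞] = 0` — the mechanism by which BPS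
(Thm. 1.1.6, Thm. 1.1.8) and Kobayashi (supersingular `p`) dispense with Schneider's conjecture in
analytic rank one. [cite: BuyukbodukPollackSasaki2018, Thm. 1.1.6] -/
theorem soloInformedPencil_rank_eq_one (hE : hasEntireLFunction_rat) (hp : 5 ≤ p)
    (hord : IsOrdinaryAt W p) (hf : IsNewformOf W f)
    (hKato : kato_selmerCorank_le_order_padicLFunction W p (f := f))
    {D₁ D₂ : WeierstrassCurve.PAdicHeightData W p} {ℓ : W.toAffine.Point →+ ℚ_[p]} {t : ℚ_[p]}
    (h : ∀ P Q, D₂.pairing P Q = D₁.pairing P Q - t * ℓ P * ℓ Q) (ht : t ≠ 0) (P : Fin 1 → W.toAffine.Point)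
    (hP : ℓ (P 0) ≠ 0) (c : ℚ) {e₁ e₂ lg : ℚ_[p]} (he₁ : e₁ ≠ 0) (he₂ : e₂ ≠ 0)
    (L₂ : PowerSeries ℚ_[p])
    (hL : W.leadingLCoeff = (((c : ℝ) * plusPeriod f * regulatorOf P : ℝ) : ℂ))
    (h₁ : PowerSeries.coeff 1 (padicLFunction f (unitRoot W p : ℚ_[p])) * lg ^ 1 =
      (c : ℚ_[p]) * e₁ * padicRegulatorOf D₁ P)
    (h₂ : PowerSeries.coeff 1 L₂ * lg ^ 1 = (c : ℚ_[p]) * e₂ * padicRegulatorOf D₂ P)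
    (hKato₂ : (W.selmerCorank p : ℕ∞) ≤ L₂.order) :
    W.mordellWeilRank = 1 ∧ W.shaCorank p = 0 :=
  soloInformedPencil_rank_eq W p f hE hp hord hf hKato h ht P c he₁ he₂ L₂ hL h₁ h₂ hKato₂
    (soloInformedPencil_noRadical_fin_one D₁ ℓ P hP)

/-- **Excess rank forces a splitting-free radical.** Same data; if `rank E(ℚ) > r` then the Gram
matrix of `D₁` on `P` has a non-zero kernel vector with `Σ xᵢ ℓ(Pᵢ) = 0` — for the Gross–Zagier
family of a curve with `r_an = r ≥ 2` this is the counterexample scenario the two-slope inputs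
leave open: all `r × r` minors of `[ℓ(Pᵢ) | ⟨Pᵢ,Pⱼ⟩_{D₁}]` vanish (at `r = 1`: impossible as soon as
`ℓ(P) ≠ 0`, `soloInformedPencil_noRadical_fin_one`). [cite: BuyukbodukPollackSasaki2018, Thm. 1.1.6] -/
theorem soloInformedPencil_common_radical_of_lt {r : ℕ} (hE : hasEntireLFunction_rat) (hp : 5 ≤ p)
    (hord : IsOrdinaryAt W p) (hf : IsNewformOf W f)
    (hKato : kato_selmerCorank_le_order_padicLFunction W p (f := f))
    {D₁ D₂ : WeierstrassCurve.PAdicHeightData W p} {ℓ : W.toAffine.Point →+ ℚ_[p]} {t : ℚ_[p]}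
    (h : ∀ P Q, D₂.pairing P Q = D₁.pairing P Q - t * ℓ P * ℓ Q) (ht : t ≠ 0) (P : Fin r → W.toAffine.Point) (c : ℚ)
    {e₁ e₂ lg : ℚ_[p]} (he₁ : e₁ ≠ 0) (he₂ : e₂ ≠ 0) (L₂ : PowerSeries ℚ_[p])
    (hL : W.leadingLCoeff = (((c : ℝ) * plusPeriod f * regulatorOf P : ℝ) : ℂ))
    (h₁ : PowerSeries.coeff r (padicLFunction f (unitRoot W p : ℚ_[p])) * lg ^ r =
      (c : ℚ_[p]) * e₁ * padicRegulatorOf D₁ P)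
    (h₂ : PowerSeries.coeff r L₂ * lg ^ r = (c : ℚ_[p]) * e₂ * padicRegulatorOf D₂ P)
    (hKato₂ : (W.selmerCorank p : ℕ∞) ≤ L₂.order) (hlt : r < W.mordellWeilRank) :
    ∃ x : Fin r → ℚ_[p], x ≠ 0 ∧ D₁.pairingMatrix P *ᵥ x = 0 ∧ (fun i => ℓ (P i)) ⬝ᵥ x = 0 := by
  by_contra hno
  have hR : ∀ x : Fin r → ℚ_[p], D₁.pairingMatrix P *ᵥ x = 0 → (fun i => ℓ (P i)) ⬝ᵥ x = 0 →
      x = 0 := fun x hBx hvx => by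
    by_contra hx
    exact hno ⟨x, hx, hBx, hvx⟩
  have h' := (soloInformedPencil_rank_eq W p f hE hp hord hf hKato h ht P c he₁ he₂ L₂ hL h₁ h₂
    hKato₂ hR).1
  omega

end OneCurve

end Summit.BirchSwinnertonDyer.BirchSwinnertonDyer.Theorems

end
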